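import Mathlib
import HarnessLib
import Summits.HubbardSuperconductivity.HubbardSuperconductivity.Theorems.KLProgrammeC4aPartnerBandChartPoint

/-!
# Route `KLProgramme` — crux C4a, S3 brick (B4) «(B4)-UMK1», «(M4)-COVER» part 4: the CAUSTIC-FREE criterion (far from every caustic and every Cooper chord at a
# near-critical loop angle ⟹ the partner level is NOT small) and the JOINT FEASIBILITY of the cover theorem's n-free thresholds

Cell `gate-hubbard-kl`, seat hubbard-kl-k3c3-p3 (g30; row «implicit-function / monotonicity route for μ(n)»).  Located brick for the (C)-closer lane hubbard-kl-c4a-1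
(stub (C) `stub_twoLeg_curvature` of `KLRegimeEngineV17F2`, stmt-HubbardSuperconductivity-20437), memo HOME/hubbard-kl-k3c3-p3/U1-CAUSTIC-SUP.md §9 (3)(a).
Parts 1–3 (`…C4aCausticWindowCover(Transversal/Dispatch)`) make every NEAR-CAUSTIC window one call; `…C4aCausticWindowTiling.intervalIntegral_caustic_free_le` makes every
window with `d₁ ≤ |δ₀|` one call.  This file supplies the bridge and the non-vacuity:
* §1 **`abs_partnerBand_ge_of_causticFree`** (contrapositive of `…C4aPartnerBandChartPoint.abs_deriv_partnerBand_pp_angle_gt_of_sheets` at loop level `0`): if the loop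
  slope is `≤ λ` at `(ϑ, φ)` and, for EVERY sheet `m`, the configuration is neither `(λ,d₁)`-Cooper relative to `2πm` nor within the `(λ,d₁)`-margin of the `m`-th caustic,
  then `d₁ ≤ |e_K(S(ϑ) − Φ(0,φ+θ))|`; **`abs_sInf_partnerBand_ge_or_edge_of_causticFree`**: on a loop window `[φa,φb]` the canonical offset
  `δ₀(ϑ) = inf_φ e_K(S(ϑ) − Φ(0,φ+θ))` is `≥ d₁` in modulus UNLESS it is attained at an edge of the loop window (an interior minimiser is critical — Fermat);
  `frameLevel_sheetBase_eq` (the family of parts 1–3 with base point `Φ(0,θ) − 2πm` IS this family: `e_K` is `2πℤ²`-periodic);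
* §2 **`exists_coverThresholds`**: for any nonnegative coefficients (the `FrameOK` sizes enter only through them) there are POSITIVE thresholds
  `(η₀, τ₀, L, Δ, ω, ρ_C)` meeting simultaneously the same-direction budget `τ₀ + 2(D₁η₀ + ρ_C/d) ≤ 3/5`, the `hΔ` domination `τ₀ + 2D₁L ≤ Δ ≤ 3/10`, `K₁Δ < r`, the
  transversal floor `c_κ(η₀ − L − c_uΔ) − c_ρ(K₁Δ + ρ_C) > 0`, the antipodal rows `η₀ + L ≤ ω`, `L ≤ ω` and the window budget `2(a_ΔΔ + b_ρρ_C + c_ωω) < bud` — so the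
  cover theorem `…C4aCausticWindowCoverDispatch.intervalIntegral_caustic_nearCaustic_umklapp_le` is NOT vacuous: windows of length `L` and radii `|ρ| ≤ ρ_C` exist n-free.
Bookkeeping on landed objects + elementary real arithmetic; nothing about the model's sizes; nothing asserts (C), K3 or superconductivity.
References: BGM 2003 §7.1 Lemma 7.1 (A1.9) [cite: BenfattoGiulianiMastropietro2003]; FST II CPAM 51 (1998) §3 [cite: FeldmanSalmhoferTrubowitz1998].
-/

noncomputable section

namespace Summit.HubbardSuperconductivity.HubbardSuperconductivity.Theorems.C4a

set_option linter.dupNamespace false -- summit = problem name (single-conjunct summit), D-0017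

open Real Set
open Literature.MathematicalPhysics.QuantumLattice Literature.MathematicalPhysics.QuantumLattice.BandSectorCounting
open Literature.MathematicalPhysics.QuantumLattice.FermiRG
open Summit.HubbardSuperconductivity.HubbardSuperconductivity.Theorems.KLRegimeSplit
open Summit.HubbardSuperconductivity.HubbardSuperconductivity.Theorems.DispersionFlow
open Summit.HubbardSuperconductivity.HubbardSuperconductivity.Theorems.PerturbedFermiCurve

/-! ## §1 The caustic-free criterion -/

/-- **The sheet base point is invisible to the band**: `e_K(Φ(0,θ) − 2πm + (q′ − p)) = e_K(S − p)` with `S = Φ(0,θ) + q′`, `q′ = Φ(ρ,ϑ+θ)` — the family of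
`…C4aCausticWindowCover` with base point `c = Φ(0,θ) − 2πm` is the loop family of `…C4aPartnerBandChartPoint` for every sheet `m`. -/
theorem frameLevel_sheetBase_eq (μ : ℝ) (K : TrigPolyC4v) (ρ ϑ θ φ : ℝ) (m : Fin 2 → ℤ) :
    frameLevel μ K (levelPoint μ K 0 θ - WithLp.toLp 2 (fun i => 2 * π * (m i : ℝ)) + (levelPoint μ K ρ (ϑ + θ) - levelPoint μ K 0 (φ + θ))) =
      frameLevel μ K (pairSumPath μ K ρ ϑ θ 0 - levelPoint μ K 0 (φ + θ)) := by
  have e : levelPoint μ K 0 θ - WithLp.toLp 2 (fun i => 2 * π * (m i : ℝ)) + (levelPoint μ K ρ (ϑ + θ) - levelPoint μ K 0 (φ + θ)) =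
      (pairSumPath μ K ρ ϑ θ 0 - levelPoint μ K 0 (φ + θ)) - WithLp.toLp 2 (fun i => 2 * π * (m i : ℝ)) := by
    simp only [pairSumPath, add_zero]; abel
  rw [e, frameLevel_sub_twoPi]

section Sizes

variable {K : TrigPolyC4v} {A : ℝ} (hA : ∀ p : Momentum, ∀ j ≤ 2, ‖iteratedFDeriv ℝ j (frameShift K) p‖ ≤ A) (hA20 : A ≤ 1 / 20)
  (hd : klCurveD ≤ (bandBounds (show (-4 : ℝ) < -1.1 by norm_num) (show (-1.1 : ℝ) ≤ -0.1 by norm_num)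
    (show (-0.1 : ℝ) < 0 by norm_num)).Dtmin - 2 * A)
  {μ r : ℝ} (hr : 0 < r) (hlo : (-1.1 : ℝ) < μ - r - A) (hhi : μ + r + A < -0.1)
  {A₃ A₄ : ℝ} (hA₃ : ∀ p : Momentum, ‖iteratedFDeriv ℝ 3 (frameShift K) p‖ ≤ A₃)
  (hA₄ : ∀ p : Momentum, ‖iteratedFDeriv ℝ 4 (frameShift K) p‖ ≤ A₄)
include hA hA20 hd hr hlo hhi hA₃ hA₄

/-- **THE CAUSTIC-FREE CRITERION** (pointwise).  Under `GeomConstants (frameLevel μ K) Kc r₀ g₀ w`, at a configuration `(ρ, ϑ, θ)` and a loop angle `φ` (loop level `0`)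
where the loop slope is small, `|∂_φ e_K(S − Φ(0,φ+θ))| ≤ λ`, let `0 ≤ d₁ ≤ r` and `τ = τ(λ, d₁)` the margin of `abs_deriv_partnerBand_pp_angle_gt_of_sheets`.  If for
EVERY sheet `m` the configuration is not `(λ,d₁)`-Cooper (`msD₁τ + d₁/(Dt−2A) < ‖S − 2πm‖`) and not within margin of the `m`-th caustic
(`msD₁τ + d₁/(Dt−2A) < ‖S − 2πm − 2Φ(0,φ+θ)‖`), then the partner level is NOT small: `d₁ ≤ |e_K(S − Φ(0,φ+θ))|`. -/
theorem abs_partnerBand_ge_of_causticFree {Kc r₀ g₀ w : ℝ} (hG : GeomConstants (frameLevel μ K) Kc r₀ g₀ w) {ρ ϑ θ φ lam d₁ : ℝ} (hd₁r : d₁ ≤ r)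
    (hslope : |deriv (fun x : ℝ => frameLevel μ K (pairSumPath μ K ρ ϑ θ 0 - levelPoint μ K 0 (x + θ))) φ| ≤ lam)
    (hC : ∀ m : Fin 2 → ℤ, msD A₃ A₄ 1 *
            ((π / 2 * lam /
                  (((bandBounds (show (-4 : ℝ) < -1.1 by norm_num) (show (-1.1 : ℝ) ≤ -0.1 by norm_num) (show (-0.1 : ℝ) < 0 by norm_num)).Dtmin -
                      2 * A) *
                    (bandBounds (show (-4 : ℝ) < -1.1 by norm_num) (show (-1.1 : ℝ) ≤ -0.1 by norm_num) (show (-0.1 : ℝ) < 0 by norm_num)).umin) +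
                π * Kc * d₁ / ((bandBounds (show (-4 : ℝ) < -1.1 by norm_num) (show (-1.1 : ℝ) ≤ -0.1 by norm_num)
                  (show (-0.1 : ℝ) < 0 by norm_num)).Dtmin - 2 * A) ^ 2) /
              ((bandBounds (show (-4 : ℝ) < -1.1 by norm_num) (show (-1.1 : ℝ) ≤ -0.1 by norm_num) (show (-0.1 : ℝ) < 0 by norm_num)).umin * w /
                (4 + 2 * A))) +
          d₁ / ((bandBounds (show (-4 : ℝ) < -1.1 by norm_num) (show (-1.1 : ℝ) ≤ -0.1 by norm_num) (show (-0.1 : ℝ) < 0 by norm_num)).Dtmin - 2 * A) <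
        ‖pairSumPath μ K ρ ϑ θ 0 - WithLp.toLp 2 (fun i => 2 * π * (m i : ℝ))‖)
    (hT : ∀ m : Fin 2 → ℤ, msD A₃ A₄ 1 *
            ((π / 2 * lam /
                  (((bandBounds (show (-4 : ℝ) < -1.1 by norm_num) (show (-1.1 : ℝ) ≤ -0.1 by norm_num) (show (-0.1 : ℝ) < 0 by norm_num)).Dtmin -
                      2 * A) *
                    (bandBounds (show (-4 : ℝ) < -1.1 by norm_num) (show (-1.1 : ℝ) ≤ -0.1 by norm_num) (show (-0.1 : ℝ) < 0 by norm_num)).umin) +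
                π * Kc * d₁ / ((bandBounds (show (-4 : ℝ) < -1.1 by norm_num) (show (-1.1 : ℝ) ≤ -0.1 by norm_num)
                  (show (-0.1 : ℝ) < 0 by norm_num)).Dtmin - 2 * A) ^ 2) /
              ((bandBounds (show (-4 : ℝ) < -1.1 by norm_num) (show (-1.1 : ℝ) ≤ -0.1 by norm_num) (show (-0.1 : ℝ) < 0 by norm_num)).umin * w /
                (4 + 2 * A))) +
          d₁ / ((bandBounds (show (-4 : ℝ) < -1.1 by norm_num) (show (-1.1 : ℝ) ≤ -0.1 by norm_num) (show (-0.1 : ℝ) < 0 by norm_num)).Dtmin - 2 * A) <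
        ‖pairSumPath μ K ρ ϑ θ 0 - WithLp.toLp 2 (fun i => 2 * π * (m i : ℝ)) - (2 : ℝ) • levelPoint μ K 0 (φ + θ)‖) :
    d₁ ≤ |frameLevel μ K (pairSumPath μ K ρ ϑ θ 0 - levelPoint μ K 0 (φ + θ))| := by
  by_contra hlt
  push Not at hlt
  have h0 : |(0 : ℝ)| < r := by simpa using hr
  have h0' : |(0 : ℝ)| < r₀ := by simpa using hG.r₀_pos
  have hē : |frameLevel μ K (pairSumPath μ K ρ ϑ θ 0 - levelPoint μ K 0 (φ + θ))| < r := lt_of_lt_of_le hlt hd₁r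
  have heps : |frameLevel μ K (pairSumPath μ K ρ ϑ θ 0 - levelPoint μ K 0 (φ + θ)) - 0| ≤ d₁ := by rw [sub_zero]; exact hlt.le
  have hT' : ∀ m : Fin 2 → ℤ, msD A₃ A₄ 1 *
            ((π / 2 * lam /
                  (((bandBounds (show (-4 : ℝ) < -1.1 by norm_num) (show (-1.1 : ℝ) ≤ -0.1 by norm_num) (show (-0.1 : ℝ) < 0 by norm_num)).Dtmin -
                      2 * A) *
                    (bandBounds (show (-4 : ℝ) < -1.1 by norm_num) (show (-1.1 : ℝ) ≤ -0.1 by norm_num) (show (-0.1 : ℝ) < 0 by norm_num)).umin) +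
                π * Kc * d₁ / ((bandBounds (show (-4 : ℝ) < -1.1 by norm_num) (show (-1.1 : ℝ) ≤ -0.1 by norm_num)
                  (show (-0.1 : ℝ) < 0 by norm_num)).Dtmin - 2 * A) ^ 2) /
              ((bandBounds (show (-4 : ℝ) < -1.1 by norm_num) (show (-1.1 : ℝ) ≤ -0.1 by norm_num) (show (-0.1 : ℝ) < 0 by norm_num)).umin * w /
                (4 + 2 * A))) +
          (2 * |(0 : ℝ)| + d₁) / ((bandBounds (show (-4 : ℝ) < -1.1 by norm_num) (show (-1.1 : ℝ) ≤ -0.1 by norm_num) (show (-0.1 : ℝ) < 0 by norm_num)).Dtmin - 2 * A) <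
        ‖pairSumPath μ K ρ ϑ θ 0 - WithLp.toLp 2 (fun i => 2 * π * (m i : ℝ)) - (2 : ℝ) • levelPoint μ K 0 (φ + θ)‖ := fun m => by
    rw [abs_zero, mul_zero, zero_add]; exact hT m
  have h := abs_deriv_partnerBand_pp_angle_gt_of_sheets hA hA20 hd hlo hhi hA₃ hA₄ hG h0 h0' hē heps hC hT'
  linarith

omit hA20 hA₃ hA₄ in
/-- The loop family `φ ↦ e_K(S − Φ(0,φ+θ))` has derivative `−De_K(S − Φ(0,φ+θ))[∂_sΦ(0,φ+θ)]` (chain rule). -/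
theorem hasDerivAt_partnerBand_loop (ρ ϑ θ φ : ℝ) :
    HasDerivAt (fun x : ℝ => frameLevel μ K (pairSumPath μ K ρ ϑ θ 0 - levelPoint μ K 0 (x + θ)))
      (-(fderiv ℝ (frameLevel μ K) (pairSumPath μ K ρ ϑ θ 0 - levelPoint μ K 0 (φ + θ)) (iteratedDeriv 1 (levelPoint μ K 0) (φ + θ)))) φ := by
  have h0 : |(0 : ℝ)| < r := by simpa using hr
  have hq : HasDerivAt (fun t : ℝ => levelPoint μ K 0 (t + θ)) (iteratedDeriv 1 (levelPoint μ K 0) (φ + θ)) φ :=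
    HasDerivAt.comp_add_const φ θ (hasDerivAt_levelPoint_angle hA hd hlo hhi h0 (φ + θ))
  have hS : HasDerivAt (fun t : ℝ => pairSumPath μ K ρ ϑ θ 0 - levelPoint μ K 0 (t + θ)) (-(iteratedDeriv 1 (levelPoint μ K 0) (φ + θ))) φ := by
    have h := hq.const_sub (pairSumPath μ K ρ ϑ θ 0)
    exact h
  have hE : DifferentiableAt ℝ (frameLevel μ K) (pairSumPath μ K ρ ϑ θ 0 - levelPoint μ K 0 (φ + θ)) :=
    ((EngineV8.contDiff_frameLevel μ K (n := 1)).differentiable one_ne_zero) _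
  have h := hE.hasFDerivAt.comp_hasDerivAt φ hS
  rw [map_neg] at h
  exact h

omit hA hA20 hd hr hlo hhi hA₃ hA₄ in
/-- At an interior minimiser of the loop family over `[φa,φb]` the loop slope vanishes (Fermat). -/
theorem deriv_partnerBand_loop_eq_zero_of_isMinOn {ρ ϑ θ φa φb φ₀ : ℝ} (hφ₀ : φ₀ ∈ Ioo φa φb)
    (hmin : IsMinOn (fun x : ℝ => frameLevel μ K (pairSumPath μ K ρ ϑ θ 0 - levelPoint μ K 0 (x + θ))) (Icc φa φb) φ₀) :
    deriv (fun x : ℝ => frameLevel μ K (pairSumPath μ K ρ ϑ θ 0 - levelPoint μ K 0 (x + θ))) φ₀ = 0 := by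
  have hloc : IsLocalMin (fun x : ℝ => frameLevel μ K (pairSumPath μ K ρ ϑ θ 0 - levelPoint μ K 0 (x + θ))) φ₀ :=
    (hmin.on_subset Ioo_subset_Icc_self).isLocalMin (Ioo_mem_nhds hφ₀.1 hφ₀.2)
  exact hloc.deriv_eq_zero

/-- **THE CAUSTIC-FREE LOOP WINDOW**: `φa ≤ φb`; if at EVERY loop angle `φ ∈ (φa,φb)` and for every sheet `m` the configuration is neither `(0,d₁)`-Cooper nor within the
`(0,d₁)`-margin of the `m`-th caustic (`0 ≤ d₁ ≤ r`), then the canonical offset `δ₀(ϑ) = inf_{φ ∈ [φa,φb]} e_K(S(ϑ) − Φ(0,φ+θ))` satisfies `d₁ ≤ |δ₀(ϑ)|` — OR it is an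
EDGE value (`δ₀(ϑ) = e_K(S − Φ(0,φa+θ))` or `= e_K(S − Φ(0,φb+θ))`: the fold sits in a neighbouring loop window).  With `…C4aCausticWindowTiling.intervalIntegral_caustic_free_le`
the first alternative is one call. -/
theorem abs_sInf_partnerBand_ge_or_edge_of_causticFree {Kc r₀ g₀ w : ℝ} (hG : GeomConstants (frameLevel μ K) Kc r₀ g₀ w) {ρ ϑ θ φa φb d₁ : ℝ}
    (hφ : φa ≤ φb) (hd₁r : d₁ ≤ r)
    (hC : ∀ m : Fin 2 → ℤ, msD A₃ A₄ 1 * ((π * Kc * d₁ / ((bandBounds (show (-4 : ℝ) < -1.1 by norm_num) (show (-1.1 : ℝ) ≤ -0.1 by norm_num) (show (-0.1 : ℝ) < 0 by norm_num)).Dtmin - 2 * A) ^ 2) / ((bandBounds (show (-4 : ℝ) < -1.1 by norm_num) (show (-1.1 : ℝ) ≤ -0.1 by norm_num) (show (-0.1 : ℝ) < 0 by norm_num)).umin * w / (4 + 2 * A))) + d₁ / ((bandBounds (show (-4 : ℝ) < -1.1 by norm_num) (show (-1.1 : ℝ) ≤ -0.1 by norm_num) (show (-0.1 : ℝ) < 0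 by norm_num)).Dtmin - 2 * A) < ‖pairSumPath μ K ρ ϑ θ 0 - WithLp.toLp 2 (fun i => 2 * π * (m i : ℝ))‖)
    (hT : ∀ φ ∈ Ioo φa φb, ∀ m : Fin 2 → ℤ,
      msD A₃ A₄ 1 * ((π * Kc * d₁ / ((bandBounds (show (-4 : ℝ) < -1.1 by norm_num) (show (-1.1 : ℝ) ≤ -0.1 by norm_num) (show (-0.1 : ℝ) < 0 by norm_num)).Dtmin - 2 * A) ^ 2) / ((bandBounds (show (-4 : ℝ) < -1.1 by norm_num) (show (-1.1 : ℝ) ≤ -0.1 by norm_num) (show (-0.1 : ℝ) < 0 by norm_num)).umin * w / (4 + 2 * A))) + d₁ / ((bandBounds (show (-4 : ℝ) < -1.1 by norm_num) (show (-1.1 : ℝ) ≤ -0.1 by norm_num) (show (-0.1 : ℝ) < 0 by norm_num)).Dtmin - 2 * A) < ‖pairSumPath μ K ρ ϑ θ 0 - WithLp.toLp 2 (fun i => 2 * π * (m i : ℝ)) - (2 : ℝ) • levelPoint μ K 0 (φ + θ)‖) :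
    d₁ ≤ |sInf ((fun φ => frameLevel μ K (pairSumPath μ K ρ ϑ θ 0 - levelPoint μ K 0 (φ + θ))) '' Icc φa φb)| ∨
      sInf ((fun φ => frameLevel μ K (pairSumPath μ K ρ ϑ θ 0 - levelPoint μ K 0 (φ + θ))) '' Icc φa φb) = frameLevel μ K (pairSumPath μ K ρ ϑ θ 0 - levelPoint μ K 0 (φa + θ)) ∨
      sInf ((fun φ => frameLevel μ K (pairSumPath μ K ρ ϑ θ 0 - levelPoint μ K 0 (φ + θ))) '' Icc φa φb) = frameLevel μ K (pairSumPath μ K ρ ϑ θ 0 - levelPoint μ K 0 (φb + θ)) := by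
  set g : ℝ → ℝ := fun φ => frameLevel μ K (pairSumPath μ K ρ ϑ θ 0 - levelPoint μ K 0 (φ + θ)) with hg
  have hcont : ContinuousOn g (Icc φa φb) := fun x _ =>
    (hasDerivAt_partnerBand_loop hA hd hr hlo hhi ρ ϑ θ x).differentiableAt.continuousAt.continuousWithinAt
  obtain ⟨φ₀, hφ₀, hφ₀eq, hφ₀le⟩ := isCompact_Icc.exists_sInf_image_eq_and_le (nonempty_Icc.2 hφ) hcont
  rw [hφ₀eq]
  -- edge or interior
  rcases eq_or_lt_of_le hφ₀.1 with hea | hlta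
  · right; left; rw [← hea]
  rcases eq_or_lt_of_le hφ₀.2 with heb | hltb
  · right; right; rw [heb]
  left
  have hint : φ₀ ∈ Ioo φa φb := ⟨hlta, hltb⟩
  have hder : deriv g φ₀ = 0 := deriv_partnerBand_loop_eq_zero_of_isMinOn hint (fun x hx => hφ₀le x hx)
  have hslope : |deriv g φ₀| ≤ 0 := by rw [hder, abs_zero]
  refine abs_partnerBand_ge_of_causticFree hA hA20 hd hr hlo hhi hA₃ hA₄ hG hd₁r hslope (fun m => ?_) (fun m => ?_)
  · rw [mul_zero, zero_div, zero_add]; exact hC m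
  · rw [mul_zero, zero_div, zero_add]; exact hT φ₀ hint m

end Sizes

/-! ## §2 The thresholds of the cover theorem are jointly feasible -/

/-- A share: `c·(b/(k(c+1))) ≤ b/k` for `c, b ≥ 0 < k`. -/
theorem mul_div_mul_succ_le {c b k : ℝ} (hc : 0 ≤ c) (hb : 0 ≤ b) (hk : 0 < k) : c * (b / (k * (c + 1))) ≤ b / k := by
  rw [← mul_div_assoc, div_le_div_iff₀ (by positivity) hk]
  nlinarith [mul_nonneg hb hk.le, mul_nonneg (mul_nonneg hc hb) hk.le]


/-- **JOINT FEASIBILITY OF THE n-FREE THRESHOLDS** (non-vacuity of `intervalIntegral_caustic_nearCaustic_umklapp_le`).  For nonnegative coefficients `D₁` (= `msD₁`), `K₁`,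
`c_u` (= `π/(2u_min)`), `c_ρ` (= `7π/(Dt−2A)²`), `a_Δ, b_ρ, c_ω` (the linear coefficients of the window budget `ε(Δ,|ρ|,ω) = a_ΔΔ + b_ρ|ρ| + c_ωω`) and positive
`d` (= `Dt − 2A`), `r`, `c_κ` (= `u_min w/(4+2A)`), `bud` (= `(9/400)u_min²`), there are POSITIVE `η₀, τ₀, L, Δ, ω, ρ_C` with: same-direction budget
`τ₀ + 2(D₁η₀ + ρ_C/d) ≤ 3/5`; `hΔ` domination `τ₀ + D₁(L + L) ≤ Δ`, `Δ ≤ 3/10`, `K₁Δ < r`; transversal floor `0 < c_κ(η₀ − L − c_uΔ) − c_ρ(K₁Δ + ρ_C)`; antipodal rows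
`η₀ + L ≤ ω`, `L ≤ ω`; window budget `2(a_ΔΔ + b_ρρ_C + c_ωω) < bud`.  (Windows of ϑ-length and loop-length `L`, radii `|ρ| ≤ ρ_C`.) -/
theorem exists_coverThresholds {D₁ d K₁ r cκ cu cρ aΔ bρ cω bud : ℝ} (hD₁ : 0 ≤ D₁) (hd : 0 < d) (hK₁ : 0 ≤ K₁) (hr : 0 < r) (hcκ : 0 < cκ)
    (hcu : 0 ≤ cu) (hcρ : 0 ≤ cρ) (haΔ : 0 ≤ aΔ) (hbρ : 0 ≤ bρ) (hcω : 0 ≤ cω) (hbud : 0 < bud) :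
    ∃ η₀ τ₀ L Δ ω ρC : ℝ, 0 < η₀ ∧ 0 < τ₀ ∧ 0 < L ∧ 0 < Δ ∧ 0 < ω ∧ 0 < ρC ∧
      τ₀ + 2 * (D₁ * η₀ + ρC / d) ≤ 3 / 5 ∧ τ₀ + D₁ * (L + L) ≤ Δ ∧ Δ ≤ 3 / 10 ∧ K₁ * Δ < r ∧
      0 < cκ * (η₀ - L - cu * Δ) - cρ * (K₁ * Δ + ρC) ∧ η₀ + L ≤ ω ∧ L ≤ ω ∧ 2 * (aΔ * Δ + bρ * ρC + cω * ω) < bud := by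
  -- ω: the budget's ω-share
  obtain ⟨ω, hω0, hω1⟩ : ∃ ω : ℝ, 0 < ω ∧ 2 * (cω * ω) ≤ bud / 4 :=
    ⟨bud / (8 * (cω + 1)), by positivity, by have := mul_div_mul_succ_le hcω hbud.le (show (0:ℝ) < 8 by norm_num); linarith⟩
  -- η₀: below ω/2 and the same-direction share
  obtain ⟨η₀, hη0, hηω, hηD⟩ : ∃ η₀ : ℝ, 0 < η₀ ∧ η₀ ≤ ω / 2 ∧ 2 * (D₁ * η₀) ≤ 1 / 4 := by
    refine ⟨min (ω / 2) (1 / (8 * (D₁ + 1))), lt_min (by positivity) (by positivity), min_le_left _ _, ?_⟩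
    have h1 : D₁ * min (ω / 2) (1 / (8 * (D₁ + 1))) ≤ D₁ * (1 / (8 * (D₁ + 1))) := mul_le_mul_of_nonneg_left (min_le_right _ _) hD₁
    have h2 := mul_div_mul_succ_le hD₁ zero_le_one (show (0:ℝ) < 8 by norm_num)
    linarith
  -- Δ: five shares
  obtain ⟨Δ, hΔ0, hΔ1, hKΔ, hcuΔ, hcρΔ, haΔ'⟩ : ∃ Δ : ℝ, 0 < Δ ∧ Δ ≤ 3 / 10 ∧ K₁ * Δ < r ∧ cu * Δ ≤ η₀ / 4 ∧ cρ * K₁ * Δ ≤ cκ * η₀ / 8 ∧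
      2 * (aΔ * Δ) ≤ bud / 4 := by
    set Δ : ℝ := min (3 / 10) (min (r / (2 * (K₁ + 1))) (min (η₀ / (4 * (cu + 1))) (min (cκ * η₀ / (8 * (cρ * K₁ + 1))) (bud / (8 * (aΔ + 1)))))) with hΔ
    have hΔ2 : Δ ≤ r / (2 * (K₁ + 1)) := (min_le_right _ _).trans (min_le_left _ _)
    have hΔ3 : Δ ≤ η₀ / (4 * (cu + 1)) := (min_le_right _ _).trans ((min_le_right _ _).trans (min_le_left _ _))
    have hΔ4 : Δ ≤ cκ * η₀ / (8 * (cρ * K₁ + 1)) := (min_le_right _ _).trans ((min_le_right _ _).trans ((min_le_right _ _).trans (min_le_left _ _)))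
    have hΔ5 : Δ ≤ bud / (8 * (aΔ + 1)) := (min_le_right _ _).trans ((min_le_right _ _).trans ((min_le_right _ _).trans (min_le_right _ _)))
    refine ⟨Δ, lt_min (by norm_num) (lt_min (by positivity) (lt_min (by positivity) (lt_min (by positivity) (by positivity)))), min_le_left _ _,
      ?_, ?_, ?_, ?_⟩
    · have h1 : K₁ * Δ ≤ K₁ * (r / (2 * (K₁ + 1))) := mul_le_mul_of_nonneg_left hΔ2 hK₁
      have h2 := mul_div_mul_succ_le hK₁ hr.le (show (0:ℝ) < 2 by norm_num)
      linarith
    · have h1 : cu * Δ ≤ cu * (η₀ / (4 * (cu + 1))) := mul_le_mul_of_nonneg_left hΔ3 hcu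
      have h2 := mul_div_mul_succ_le hcu hη0.le (show (0:ℝ) < 4 by norm_num)
      linarith
    · have h0 : 0 ≤ cρ * K₁ := mul_nonneg hcρ hK₁
      have h1 : cρ * K₁ * Δ ≤ cρ * K₁ * (cκ * η₀ / (8 * (cρ * K₁ + 1))) := mul_le_mul_of_nonneg_left hΔ4 h0
      have h2 := mul_div_mul_succ_le h0 (by positivity : 0 ≤ cκ * η₀) (show (0:ℝ) < 8 by norm_num)
      linarith
    · have h1 : aΔ * Δ ≤ aΔ * (bud / (8 * (aΔ + 1))) := mul_le_mul_of_nonneg_left hΔ5 haΔ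
      have h2 := mul_div_mul_succ_le haΔ hbud.le (show (0:ℝ) < 8 by norm_num)
      linarith
  -- ρ_C: three shares
  obtain ⟨ρC, hρ0, hρ1, hρ2, hρ3⟩ : ∃ ρC : ℝ, 0 < ρC ∧ cρ * ρC ≤ cκ * η₀ / 8 ∧ 2 * (bρ * ρC) ≤ bud / 4 ∧ 2 * (ρC / d) ≤ 1 / 4 := by
    set ρC : ℝ := min (cκ * η₀ / (8 * (cρ + 1))) (min (bud / (8 * (bρ + 1))) (d / 8)) with hρC
    have h1 : ρC ≤ cκ * η₀ / (8 * (cρ + 1)) := min_le_left _ _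
    have h2 : ρC ≤ bud / (8 * (bρ + 1)) := (min_le_right _ _).trans (min_le_left _ _)
    have h3 : ρC ≤ d / 8 := (min_le_right _ _).trans (min_le_right _ _)
    refine ⟨ρC, lt_min (by positivity) (lt_min (by positivity) (by positivity)), ?_, ?_, ?_⟩
    · have h4 : cρ * ρC ≤ cρ * (cκ * η₀ / (8 * (cρ + 1))) := mul_le_mul_of_nonneg_left h1 hcρ
      have h5 := mul_div_mul_succ_le hcρ (by positivity : 0 ≤ cκ * η₀) (show (0:ℝ) < 8 by norm_num)
      linarith
    · have h4 : bρ * ρC ≤ bρ * (bud / (8 * (bρ + 1))) := mul_le_mul_of_nonneg_left h2 hbρ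
      have h5 := mul_div_mul_succ_le hbρ hbud.le (show (0:ℝ) < 8 by norm_num)
      linarith
    · rw [← mul_div_assoc, div_le_iff₀ hd]
      linarith
  -- L: a quarter of η₀ and the hΔ share
  obtain ⟨L, hL0, hL1, hL2⟩ : ∃ L : ℝ, 0 < L ∧ L ≤ η₀ / 4 ∧ D₁ * (L + L) ≤ Δ / 2 := by
    refine ⟨min (η₀ / 4) (Δ / (4 * (D₁ + 1))), lt_min (by positivity) (by positivity), min_le_left _ _, ?_⟩
    have h1 : D₁ * min (η₀ / 4) (Δ / (4 * (D₁ + 1))) ≤ D₁ * (Δ / (4 * (D₁ + 1))) := mul_le_mul_of_nonneg_left (min_le_right _ _) hD₁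
    have h2 := mul_div_mul_succ_le hD₁ hΔ0.le (show (0:ℝ) < 4 by norm_num)
    have e : D₁ * (min (η₀ / 4) (Δ / (4 * (D₁ + 1))) + min (η₀ / 4) (Δ / (4 * (D₁ + 1)))) = 2 * (D₁ * min (η₀ / 4) (Δ / (4 * (D₁ + 1)))) := by ring
    rw [e]
    linarith
  -- τ₀
  obtain ⟨τ₀, hτ0, hτ1, hτ2⟩ : ∃ τ₀ : ℝ, 0 < τ₀ ∧ τ₀ ≤ Δ / 2 ∧ τ₀ ≤ 1 / 10 :=
    ⟨min (Δ / 2) (1 / 10), lt_min (by positivity) (by norm_num), min_le_left _ _, min_le_right _ _⟩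
  refine ⟨η₀, τ₀, L, Δ, ω, ρC, hη0, hτ0, hL0, hΔ0, hω0, hρ0, ?_, ?_, hΔ1, hKΔ, ?_, ?_, ?_, ?_⟩
  · linarith
  · linarith
  · -- the transversal floor: `η₀ − L − c_uΔ ≥ η₀/2`, `c_ρ(K₁Δ + ρ_C) ≤ c_κη₀/4`
    have h1 : η₀ / 2 ≤ η₀ - L - cu * Δ := by linarith
    have h2 : cκ * (η₀ / 2) ≤ cκ * (η₀ - L - cu * Δ) := mul_le_mul_of_nonneg_left h1 hcκ.le
    have h3 : cρ * (K₁ * Δ + ρC) = cρ * K₁ * Δ + cρ * ρC := by ring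
    have h4 : 0 < cκ * η₀ := mul_pos hcκ hη0
    rw [h3]
    linarith
  · linarith
  · linarith
  · linarith

end Summit.HubbardSuperconductivity.HubbardSuperconductivity.Theorems.C4a

end
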